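import Mathlib
import HarnessLib
import Literature.MathematicalPhysics.QuantumLattice.GaugeGroups
import Literature.MathematicalPhysics.QuantumFieldTheory.ConstructiveQFTWave0
import Literature.MathematicalPhysics.QuantumFieldTheory.UnitaryCayleyChart
import Summits.Ventures.LatticeQCDFlow.Scaling.Conjectures
import Summits.Ventures.LatticeQCDFlow.Scaling.LatticeEntropyUN
import Summits.Ventures.LatticeQCDFlow.Scaling.ExactTransportVolume

/-!
# LatticeQCDFlow / Scaling — (C2a) for `U(N)` with the Hilbert–Schmidt metric: exact transport is `e^{cβ}`-bi-Lipschitz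

HONEST FRAMING: exact (Metropolis-corrected) sampling algorithms for lattice gauge theory; figures of merit are
autocorrelation/cost numbers at stated couplings and volumes; no continuum-physics claim.

Venture `LatticeQCDFlow` (cell pub-lqcd), topic `Scaling`, FANOUT row 30 (lean-1) — OUR WORK.  The instance `G = U(N)`
(`N ≥ 2`), `ρ` = defining representation, `d ≥ 2`, of the conjecture item `Conjectures.ExactTransportBiLipschitz`
((C2a), THEORY-2.md §3.3), for the HILBERT–SCHMIDT (Frobenius) metric on `U(N) ⊆ M_N(ℂ)` (the metric structure the
tree's `Matrix.Norms.Frobenius` scope puts on the unitary group; configurations carry the sup metric):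
`UN.exactTransportBiLipschitz`.  It is `exactTransportBiLipschitz_of_ballVolumes` (`Scaling/ExactTransportVolume.lean`)
fed with

* (V) the two-sided ball volumes `a·r^{N²} ≤ σ(B̄(g,r)) ≤ A·r^{N²}` of `Scaling/LatticeEntropyUN.lean` (balls about any
  centre are translates of `UnitaryCayley.gball`, `UnitaryCayley.haar_setOf_norm_sub_le`);
* (S) the EXTENSIVE ACTION `S(V⋆) ≥ 4·L^d` of the constant configuration `V⋆(x,0) = X`, `V⋆(x,1) = Z`, `V⋆ = 1`
  otherwise, `X` = the permutation matrix of the transposition `(0 1)`, `Z = diag(-1,1,…,1)`: the `(0,1)`-plaquettes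
  have holonomy `XZX⁻¹Z⁻¹ = diag(-1,-1,1,…,1)`, action `N - Re tr = 4` (this is where `N ≥ 2`, `d ≥ 2` enter; for
  `N = 1` the item fails at `L = 1`, where every `U(1)` plaquette holonomy is a trivial commutator);
* `-N ≤ Re tr U ≤ N` on `U(N)`.

Constants: `c = 1/(2N²d)`, `β₀ = 4d·log(A/a)`.  The statement is given with the instance arguments of the item written
out (`Subtype.metricSpace` and the tree's topological-group / compactness / Borel instances of `U(N)`, which live on the
definitionally equal subtype topology).  Elementary given the tree; nothing here is cited as a fact.
-/

noncomputable section

open scoped Matrix.Norms.Frobenius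
open MeasureTheory Metric Set
open Literature.MathematicalPhysics.QuantumFieldTheory
open Literature.MathematicalPhysics.QuantumFieldTheory.UnitaryCayley (𝔾 gball haar_setOf_norm_sub_le)
open Literature.MathematicalPhysics.QuantumLattice (unitaryFundamentalRep unitaryFundamentalRep_apply
  continuous_unitaryFundamentalRep)

namespace Summit.Ventures.LatticeQCDFlow.Theory2.Lattice.UN

variable {N : ℕ}

/-! ## §1. Hilbert–Schmidt balls in `U(N)` and their Haar volume; the trace bound -/

/-- Balls of the Hilbert–Schmidt metric on `U(N)` are Frobenius-norm balls. [folklore] -/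
theorem closedBall_eq (g : 𝔾 N) (r : ℝ) :
    closedBall g r = {U : 𝔾 N | ‖(U : Matrix (Fin N) (Fin N) ℂ) - g‖ ≤ r} := by
  ext U
  rw [mem_closedBall, Subtype.dist_eq, dist_eq_norm]
  rfl

/-- Haar volume of a ball about any centre is that of the ball about `1`. [folklore] -/
theorem haar_closedBall (g : 𝔾 N) (r : ℝ) :
    haarProbability (𝔾 N) (closedBall g r) = haarProbability (𝔾 N) (gball N r) := by
  rw [closedBall_eq, haar_setOf_norm_sub_le]

/-- (V), lower half: `a·r^{N²} ≤ σ(B̄(g,r))` for `0 < r ≤ 1`. [folklore] -/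
theorem haar_closedBall_ge : ∃ a : ℝ, 0 < a ∧ ∀ (g : 𝔾 N) (r : ℝ), 0 < r → r ≤ 1 →
    a * r ^ (N * N) ≤ (haarProbability (𝔾 N) (closedBall g r)).toReal := by
  obtain ⟨a, ha, h⟩ := haar_gball_ge (N := N)
  exact ⟨a, ha, fun g r hr hr1 => by rw [haar_closedBall]; exact h r hr hr1⟩

/-- (V), upper half: `σ(B̄(g,r)) ≤ A·r^{N²}` for `0 < r`. [folklore] -/
theorem haar_closedBall_le : ∃ A : ℝ, 0 < A ∧ ∀ (g : 𝔾 N) (r : ℝ), 0 < r →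
    (haarProbability (𝔾 N) (closedBall g r)).toReal ≤ A * r ^ (N * N) := by
  obtain ⟨A, hA, h⟩ := haar_gball_le (N := N)
  exact ⟨A, hA, fun g r hr => by rw [haar_closedBall]; exact h r hr⟩

/-- `-N ≤ Re tr U` on `U(N)` (entries of norm `≤ 1`). [folklore] -/
theorem neg_le_re_trace (U : 𝔾 N) : -(N : ℝ) ≤ (unitaryFundamentalRep (Fin N) ℂ U).trace.re := by
  rw [unitaryFundamentalRep_apply, Matrix.trace, Complex.re_sum]
  calc -(N : ℝ) = ∑ _i : Fin N, (-1 : ℝ) := by simp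
    _ ≤ ∑ i, ((U : Matrix (Fin N) (Fin N) ℂ).diag i).re := Finset.sum_le_sum fun i _ => by
        have h1 := entry_norm_bound_of_unitary U.2 i i
        have h2 := Complex.abs_re_le_norm ((U : Matrix (Fin N) (Fin N) ℂ) i i)
        rw [Matrix.diag_apply]
        linarith [(abs_le.1 h2).1]

/-! ## §2. Two anticommuting unitaries: the transposition matrix `X` and the sign matrix `Z` -/

section Pauli

variable (i₀ i₁ : Fin N)

/-- The permutation matrix `X` of the transposition `(i₀ i₁)`. [folklore] -/
def swapM : Matrix (Fin N) (Fin N) ℂ := ((Equiv.swap i₀ i₁).toPEquiv.toMatrix : Matrix (Fin N) (Fin N) ℂ)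

/-- The sign vector `(-1 at i₀, 1 elsewhere)`. [folklore] -/
def signV : Fin N → ℂ := fun i => if i = i₀ then -1 else 1

/-- The sign matrix `Z = diag(-1 at i₀, 1 elsewhere)`. [folklore] -/
def signM : Matrix (Fin N) (Fin N) ℂ := Matrix.diagonal (signV i₀)

/-- `X² = 1`. [folklore] -/
theorem swapM_mul_swapM : swapM i₀ i₁ * swapM i₀ i₁ = 1 := by
  unfold swapM
  rw [← PEquiv.toMatrix_trans, ← Equiv.toPEquiv_trans, Equiv.swap_swap, Equiv.toPEquiv_refl,
    PEquiv.toMatrix_refl]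

/-- `X` is Hermitian (real symmetric): `Xᴴ = X`. [folklore] -/
theorem conjTranspose_swapM : (swapM i₀ i₁).conjTranspose = swapM i₀ i₁ := by
  ext i j
  simp only [swapM, Matrix.conjTranspose_apply, PEquiv.toMatrix_apply, Equiv.toPEquiv_apply,
    Option.mem_def, Option.some.injEq]
  by_cases h : i = Equiv.swap i₀ i₁ j
  · have h' : j = Equiv.swap i₀ i₁ i := by rw [h, Equiv.swap_apply_self]
    rw [if_pos h.symm, if_pos h'.symm, star_one]
  · have h' : ¬ j = Equiv.swap i₀ i₁ i := fun hj => h (by rw [hj, Equiv.swap_apply_self])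
    rw [if_neg (Ne.symm h), if_neg (Ne.symm h'), star_zero]

/-- `X ∈ U(N)`. [folklore] -/
theorem swapM_mem : swapM i₀ i₁ ∈ Matrix.unitaryGroup (Fin N) ℂ := by
  rw [Matrix.mem_unitaryGroup_iff, Matrix.star_eq_conjTranspose, conjTranspose_swapM, swapM_mul_swapM]

/-- `Z² = 1`. [folklore] -/
theorem signM_mul_signM : signM i₀ * signM i₀ = 1 := by
  unfold signM
  rw [Matrix.diagonal_mul_diagonal, ← Matrix.diagonal_one]
  congr 1
  funext i
  simp only [signV]
  split_ifs <;> norm_num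

/-- `Z` is Hermitian: `Zᴴ = Z`. [folklore] -/
theorem conjTranspose_signM : (signM i₀).conjTranspose = signM i₀ := by
  unfold signM
  rw [Matrix.diagonal_conjTranspose]
  congr 1
  funext i
  simp only [Pi.star_apply, signV, apply_ite (star : ℂ → ℂ), star_neg, star_one]

/-- `Z ∈ U(N)`. [folklore] -/
theorem signM_mem : signM i₀ ∈ Matrix.unitaryGroup (Fin N) ℂ := by
  rw [Matrix.mem_unitaryGroup_iff, Matrix.star_eq_conjTranspose, conjTranspose_signM, signM_mul_signM]

/-- **The commutator `X Z X Z = diag((σ·v)·v)`**, `σ = (i₀ i₁)`. [folklore] -/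
theorem swapM_signM_swapM_signM :
    swapM i₀ i₁ * signM i₀ * swapM i₀ i₁ * signM i₀ =
      Matrix.diagonal (fun i => signV i₀ (Equiv.swap i₀ i₁ i) * signV i₀ i) := by
  have h1 : swapM i₀ i₁ * signM i₀ * swapM i₀ i₁ = Matrix.diagonal (signV i₀ ∘ Equiv.swap i₀ i₁) := by
    unfold swapM signM
    rw [PEquiv.toMatrix_toPEquiv_mul, PEquiv.mul_toMatrix_toPEquiv, Matrix.submatrix_submatrix,
      Equiv.symm_swap]
    exact Matrix.submatrix_diagonal_equiv _ _
  rw [h1, signM, Matrix.diagonal_mul_diagonal]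
  rfl

/-- Its trace: `tr(XZXZ) = N - 4` when `i₀ ≠ i₁`. [folklore] -/
theorem trace_comm (h01 : i₀ ≠ i₁) :
    (swapM i₀ i₁ * signM i₀ * swapM i₀ i₁ * signM i₀).trace = (N : ℂ) - 4 := by
  rw [swapM_signM_swapM_signM, Matrix.trace_diagonal]
  have hterm : ∀ i : Fin N, signV i₀ (Equiv.swap i₀ i₁ i) * signV i₀ i =
      1 + ((if i = i₀ then -2 else 0) + (if i = i₁ then -2 else 0)) := by
    intro i
    by_cases hi0 : i = i₀
    · subst hi0
      simp only [signV, Equiv.swap_apply_left, if_neg (Ne.symm h01), if_true, if_neg h01]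
      norm_num
    · by_cases hi1 : i = i₁
      · subst hi1
        simp only [signV, Equiv.swap_apply_right, if_true, if_neg hi0]
        norm_num
      · simp only [signV, Equiv.swap_apply_of_ne_of_ne hi0 hi1, if_neg hi0, if_neg hi1]
        norm_num
  simp_rw [hterm]
  rw [Finset.sum_add_distrib, Finset.sum_add_distrib, Finset.sum_const, Finset.card_univ, Fintype.card_fin,
    Finset.sum_ite_eq' Finset.univ i₀, Finset.sum_ite_eq' Finset.univ i₁]
  simp only [Finset.mem_univ, if_true, nsmul_eq_mul, mul_one]
  ring

/-- The group elements. [folklore] -/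
def gX : 𝔾 N := ⟨swapM i₀ i₁, swapM_mem i₀ i₁⟩

/-- The group elements. [folklore] -/
def gZ : 𝔾 N := ⟨signM i₀, signM_mem i₀⟩

/-- `X⁻¹ = X` in `U(N)`. [folklore] -/
theorem gX_inv : (gX i₀ i₁)⁻¹ = gX i₀ i₁ :=
  inv_eq_of_mul_eq_one_right (Subtype.ext (swapM_mul_swapM i₀ i₁))

/-- `Z⁻¹ = Z` in `U(N)`. [folklore] -/
theorem gZ_inv : (gZ i₀ : 𝔾 N)⁻¹ = gZ i₀ :=
  inv_eq_of_mul_eq_one_right (Subtype.ext (signM_mul_signM i₀))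

/-- **The commutator has plaquette action `4`**: `N - Re tr(X Z X⁻¹ Z⁻¹) = 4`. [folklore] -/
theorem action_comm (h01 : i₀ ≠ i₁) :
    (N : ℝ) - (unitaryFundamentalRep (Fin N) ℂ (gX i₀ i₁ * gZ i₀ * (gX i₀ i₁)⁻¹ * (gZ i₀)⁻¹)).trace.re = 4 := by
  rw [gX_inv, gZ_inv, unitaryFundamentalRep_apply]
  have h : ((gX i₀ i₁ * gZ i₀ * gX i₀ i₁ * gZ i₀ : 𝔾 N) : Matrix (Fin N) (Fin N) ℂ) =
      swapM i₀ i₁ * signM i₀ * swapM i₀ i₁ * signM i₀ := rfl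
  rw [h, trace_comm i₀ i₁ h01]
  simp

end Pauli

/-! ## §3. The extensive configuration: action `≥ 4·L^d` -/

/-- **(S) for `U(N)`, `N ≥ 2`, `d ≥ 2`**: the configuration `V⋆` with `X` on direction-`0` links, `Z` on direction-`1`
links and `1` elsewhere has Wilson action `≥ 4·L^d` (every `(0,1)`-plaquette contributes exactly `4`). [folklore] -/
theorem exists_action_ge (hN : 2 ≤ N) {d : ℕ} (hd : 2 ≤ d) (L : ℕ) [NeZero L] :
    ∃ V : GaugeConfig d L (𝔾 N), 4 * (L : ℝ) ^ d ≤ wilsonAction (unitaryFundamentalRep (Fin N) ℂ) V := by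
  set i₀ : Fin N := ⟨0, by omega⟩ with hi₀
  set i₁ : Fin N := ⟨1, by omega⟩ with hi₁
  have h01 : i₀ ≠ i₁ := by simp [hi₀, hi₁, Fin.ext_iff]
  set j₀ : Fin d := ⟨0, by omega⟩ with hj₀
  set j₁ : Fin d := ⟨1, by omega⟩ with hj₁
  have hj : j₀ ≠ j₁ := by simp [hj₀, hj₁, Fin.ext_iff]
  have hjlt : j₀ < j₁ := by simp [hj₀, hj₁, Fin.lt_def]
  -- the configuration
  refine ⟨fun e => if e.2 = j₀ then gX i₀ i₁ else if e.2 = j₁ then gZ i₀ else 1, ?_⟩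
  -- per-plaquette action as a function of (site, plane)
  set f : Site d L → {p : Fin d × Fin d // p.1 < p.2} → ℝ := fun x q =>
    (N : ℝ) - (unitaryFundamentalRep (Fin N) ℂ (plaquetteHolonomy
      (fun e : Edge d L => if e.2 = j₀ then gX i₀ i₁ else if e.2 = j₁ then gZ i₀ else 1) x q.1.1 q.1.2)).trace.re
    with hf
  have hsum : wilsonAction (unitaryFundamentalRep (Fin N) ℂ)
      (fun e : Edge d L => if e.2 = j₀ then gX i₀ i₁ else if e.2 = j₁ then gZ i₀ else 1) =
        ∑ x : Site d L, ∑ q : {p : Fin d × Fin d // p.1 < p.2}, f x q := by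
    unfold wilsonAction
    rw [Fintype.sum_prod_type]
  have hnn : ∀ x q, 0 ≤ f x q := fun x q => sub_nonneg.2 (re_trace_le _)
  have hterm : ∀ x : Site d L, f x ⟨(j₀, j₁), hjlt⟩ = 4 := by
    intro x
    have hhol : plaquetteHolonomy
        (fun e : Edge d L => if e.2 = j₀ then gX i₀ i₁ else if e.2 = j₁ then gZ i₀ else 1) x j₀ j₁ =
          gX i₀ i₁ * gZ i₀ * (gX i₀ i₁)⁻¹ * (gZ i₀)⁻¹ := by
      simp only [plaquetteHolonomy, if_true, if_neg (Ne.symm hj)]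
    show (N : ℝ) - (unitaryFundamentalRep (Fin N) ℂ (plaquetteHolonomy
      (fun e : Edge d L => if e.2 = j₀ then gX i₀ i₁ else if e.2 = j₁ then gZ i₀ else 1) x j₀ j₁)).trace.re = 4
    rw [hhol]
    exact action_comm i₀ i₁ h01
  have hx : ∀ x : Site d L, (4 : ℝ) ≤ ∑ q : {p : Fin d × Fin d // p.1 < p.2}, f x q := by
    intro x
    rw [← hterm x]
    exact Finset.single_le_sum (fun q _ => hnn x q) (Finset.mem_univ _)
  have hV : Fintype.card (Site d L) = L ^ d := by simp [ZMod.card, Fintype.card_fin]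
  rw [hsum]
  calc 4 * (L : ℝ) ^ d = ∑ _x : Site d L, (4 : ℝ) := by
        rw [Finset.sum_const, Finset.card_univ, hV, nsmul_eq_mul]; push_cast; ring
    _ ≤ ∑ x : Site d L, ∑ q : {p : Fin d × Fin d // p.1 < p.2}, f x q := Finset.sum_le_sum fun x _ => hx x

/-! ## §4. The instance (C2a) for `U(N)`, Hilbert–Schmidt metric -/

/-- The Hilbert–Schmidt metric topology of `U(N)` is its subtype topology: the tree's instances transfer.
[folklore] -/
theorem isTopologicalGroup_hs :
    @IsTopologicalGroup (𝔾 N) (@UniformSpace.toTopologicalSpace _ (@PseudoMetricSpace.toUniformSpace _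
      (@MetricSpace.toPseudoMetricSpace (𝔾 N) Subtype.metricSpace))) _ :=
  (inferInstance : IsTopologicalGroup (𝔾 N))

/-- Compactness of `U(N)` in the Hilbert–Schmidt metric topology. [folklore] -/
theorem compactSpace_hs :
    @CompactSpace (𝔾 N) (@UniformSpace.toTopologicalSpace _ (@PseudoMetricSpace.toUniformSpace _
      (@MetricSpace.toPseudoMetricSpace (𝔾 N) Subtype.metricSpace))) :=
  (inferInstance : CompactSpace (𝔾 N))

/-- Second countability of `U(N)` in the Hilbert–Schmidt metric topology. [folklore] -/
theorem secondCountable_hs :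
    @SecondCountableTopology (𝔾 N) (@UniformSpace.toTopologicalSpace _ (@PseudoMetricSpace.toUniformSpace _
      (@MetricSpace.toPseudoMetricSpace (𝔾 N) Subtype.metricSpace))) :=
  (inferInstance : SecondCountableTopology (𝔾 N))

/-- The Borel structure of `U(N)` in the Hilbert–Schmidt metric topology. [folklore] -/
theorem borelSpace_hs :
    @BorelSpace (𝔾 N) (@UniformSpace.toTopologicalSpace _ (@PseudoMetricSpace.toUniformSpace _
      (@MetricSpace.toPseudoMetricSpace (𝔾 N) Subtype.metricSpace))) _ :=
  (inferInstance : BorelSpace (𝔾 N))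

/-- **(C2a) for `U(N)`, `N ≥ 2`, `d ≥ 2`, Hilbert–Schmidt metric** (OURS; closes this instance of the conjecture item
`Conjectures.ExactTransportBiLipschitz`): there are `c > 0`, `β₀` such that for every `L`, every `β ≥ β₀` and every
bi-Lipschitz `T : U(N)^E → U(N)^E` (sup metric) with `T_*Haar^{⊗E} = μ_{Λ,β}`, `Lip(T)·coLip(T) ≥ e^{cβ}`. [folklore] -/
theorem exactTransportBiLipschitz (d N : ℕ) (hd : 2 ≤ d) (hN : 2 ≤ N) :
    @Conjectures.ExactTransportBiLipschitz d N (𝔾 N) _ Subtype.metricSpace isTopologicalGroup_hs compactSpace_hs _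
      borelSpace_hs (unitaryFundamentalRep (Fin N) ℂ) := by
  obtain ⟨a, ha, hlo⟩ := haar_closedBall_ge (N := N)
  obtain ⟨A, hA, hup⟩ := haar_closedBall_le (N := N)
  have hκ : 0 < N * N := Nat.mul_pos (by omega) (by omega)
  exact @exactTransportBiLipschitz_of_ballVolumes N (𝔾 N) _ Subtype.metricSpace isTopologicalGroup_hs
    compactSpace_hs secondCountable_hs _ borelSpace_hs (unitaryFundamentalRep (Fin N) ℂ) d (by omega)
    (continuous_unitaryFundamentalRep (Fin N) ℂ) re_trace_le neg_le_re_trace (N * N) hκ a A ha hlo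
    (fun g r hr => hup g r hr) 4 (by norm_num) (fun L _ => exists_action_ge hN hd L)

end Summit.Ventures.LatticeQCDFlow.Theory2.Lattice.UN

end
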